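import Literature.Geometry.Lorentzian.Basic
import Literature.Geometry.Lorentzian.KerrHyperboloidalLeaves
import Literature.Geometry.Lorentzian.KerrSchildDivergence
import HarnessLib
import Mathlib.Analysis.Calculus.Deriv.Comp
import Mathlib.Analysis.Calculus.Deriv.Mul
import Mathlib.Analysis.Calculus.Deriv.Prod
import Mathlib.Analysis.Complex.RealDeriv
import Mathlib.Analysis.InnerProductSpace.Calculus
import Mathlib.Analysis.InnerProductSpace.Laplacian
import Mathlib.Analysis.SpecialFunctions.Complex.Arg
import Mathlib.Analysis.SpecialFunctions.Trigonometric.Deriv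
import Mathlib.Analysis.SpecialFunctions.Trigonometric.Inverse
import Mathlib.Tactic.Module

/-!
# Kerr's ingoing spheroidal coordinates on the Kerr–Schild leaf, and the flat Laplacian in them

Infrastructure for separating variables on the leaves `{t_KS = const}` of the prelude's ingoing
Kerr–Schild Cartesian chart (`KerrSchild.lean`, `KerrHyperboloidalLeaves.lean`), in three parts.

**1. The spherical orthonormal frame of `E3 = ℝ³`.** For angles `(θ, φ)`: the radial unit vector
`n̂(θ, φ) = (cos φ sin θ, sin φ sin θ, cos θ)` (`sphRadial`), the polar unit vector
`θ̂ = ∂_θ n̂ = (cos φ cos θ, sin φ cos θ, −sin θ)` (`sphPolar`), the azimuthal unit vector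
`φ̂ = (−sin φ, cos φ, 0)` (`sphAzimuth`, `∂_φ n̂ = sin θ φ̂`) and `∂_φ φ̂ = (−cos φ, −sin φ, 0) =
−(sin θ n̂ + cos θ θ̂)` (`sphHoriz`, `sphHoriz_eq`); the derivative table in `θ` and `φ`
(`hasDerivAt_sphRadial_theta`, …, one-variable `HasDerivAt`, componentwise), and the **trace identity** `B(n̂,n̂) + B(θ̂,θ̂) + B(φ̂,φ̂) = Σ_i B(e_i,e_i)`
for every continuous bilinear `B` (`sph_frame_trace`; the frame is orthonormal). Mathlib has plane
polar coordinates (`polarCoord`) but no spherical frame; these are textbook formulas, `[folklore]`.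

**2. Kerr's ingoing spheroidal coordinates.** The spatial part of Kerr's original advanced
coordinates `(u, r, θ, φ)` read on a leaf:
`Y_a(r, θ, φ) = r n̂ + a sin θ φ̂ = ((r cos φ − a sin φ) sin θ, (r sin φ + a cos φ) sin θ, r cos θ)`,
i.e. `x + iy = (r + ia) e^{iφ} sin θ`, `z = r cos θ` (`Kerr.kerrStar`; Kerr, PRL 11 (1963); Visser
arXiv:0706.0622, §4: the transformation between (E:K1) and (E:K2), with `t = u − r`). Along `Y_a`
the Kerr–Schild radius is the coordinate `r` (`radius_kerrStar`: `Y_a` solves the defining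
quartic `(x² + y²)/(r² + a²) + z²/r² = 1`), the spatial null vector is the radial unit vector,
`ℓ⃗(Y_a) = n̂ = ∂_r Y_a` (`nullSpatial_kerrStar` — this fixes the orientation of `φ`: with the
components `ℓ = (1, (rx + ay)/(r² + a²), (ry − ax)/(r² + a²), z/r)` of Visser (34) =
`Kerr.nullCovectorFun` one needs `x + iy = (r + ia)e^{iφ} sin θ`; loc. cit. prints `(r − ia)e^{iφ}`
for the oppositely oriented azimuth of (E:K1)), so the null lines are the `r`-coordinate lines
(`kerrStar_add`, cf. `Kerr.radius_add_smul_nullVector`), `Σ = r² + a² cos² θ` and `H = Mr/Σ`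
(`blSigma_kerrStar`, `scalarH_kerrStar`). In Shlapentokh-Rothman's Kerr-star coordinates
`(t*, r, θ, φ*)` (CMP 329 (2014), §1.2.1: `t* = t + t̄`, `φ* = φ + φ̄`, `dt̄/dr = (r² + a²)/Δ`,
`dφ̄/dr = a/Δ`) these are `φ = φ*`, `t_KS = t* − r` (the *untwisted* oblate spheroidal parametrisation
`(r, ω) ↦ (√(r² + a²) ω₁, √(r² + a²) ω₂, r ω₃)` of `KerrDataProofs.lean`, `Kerr.radius_spheroidal`,
differs from `Y_a` by the rotation `φ ↦ φ + arctan(a/r)` and does not straighten the null lines). Further: every off-axis point of the leaf is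
`Y_a(r, θ, φ)` with `r` its radius and `θ ∈ (0, π)` (`exists_kerrStar_eq`), the bounds `|z| ≤ r`,
`‖y‖ ≤ r + |a|` on the leaf, and the density principle `eqOn_slice_of_offAxis` (a function
continuous on `Kerr.slice` and constant off the axis `{x = y = 0}` is constant) used to pass
identities proved in the coordinates to the axis.

**3. The flat Laplacian in these coordinates.** For `Φ` of class `C²` near `y = Y_a(r, θ, φ)`,
`sin θ ≠ 0`, and `F = Φ ∘ Y_a`:
`(r² + a² cos² θ) ΔΦ(y) = ∂_r((r² + a²) ∂_r F) + (1/sin θ) ∂_θ(sin θ ∂_θ F) + (1/sin² θ) ∂_φ² F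
 + a (∂_r∂_φ F + ∂_φ∂_r F)` (`laplacian_kerrStar`, `Δ` = Mathlib's `Laplacian.laplacian`, all
partial derivatives one-variable `deriv`s) — flat space in the twisted oblate coordinates, i.e. the
spatial stationary part at `M = 0` of the Kerr wave operator in Kerr-star coordinates (SR §1.2.1:
`ρ² g^{rr} = Δ`, `ρ² g^{θθ} = 1`, `ρ² g^{φ*φ*} = 1/sin² θ`, `ρ² g^{rφ*} = a`, `√|g| = ρ² sin θ`). Proof:
chain rule along the coordinate curves (`∂_θ Y = r θ̂ + a cos θ φ̂`,
`∂_φ Y = sin θ (r φ̂ − a sin θ n̂ − a cos θ θ̂)`), the linear-algebra identities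
`frame_bilinear_identity`, `frame_vector_identity`, and `sph_frame_trace` via
`InnerProductSpace.laplacian_eq_iteratedFDeriv_orthonormalBasis`.

## References
* R. P. Kerr, Phys. Rev. Lett. 11 (1963) 237–238 (the coordinates `(u, r, θ, φ)`;
  `x + iy = (r + ia)e^{iφ} sin θ` up to orientation).
* M. Visser, *The Kerr spacetime: a brief introduction*, arXiv:0706.0622, §3 (E:K1), §4 (E:K2) and
  the displayed transformation; (33)–(35) (key `arXiv07060622`).
* Y. Shlapentokh-Rothman, Comm. Math. Phys. 329 (2014) 859–891, §1.2.1 (Kerr-star coordinates and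
  the Kerr-star form of `g`) (key `ShlapentokhRothman2014KleinGordon`).
-/

/-! ## Part 1. The spherical orthonormal frame `(n̂, θ̂, φ̂)` of `E3` -/

noncomputable section

open Real

namespace Literature.Geometry.Lorentzian

/-! ### Curves in Euclidean space, componentwise -/

/-- A curve `f : ℝ → EuclideanSpace ℝ ι` has derivative `f'` at `x` iff each component
`t ↦ f t i` has derivative `f' i` (componentwise differentiation in `ℝⁿ`). The same statement is
proved as `Literature.Barriers.FinalStateConjecture.Kerr.hasDerivAt_euclidean` in a barrier proofs
file; it is kept as a private helper here so that `Literature/Geometry` does not import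
`Literature/Barriers`. [folklore] -/
private theorem hasDerivAt_euclidean_iff {ι : Type*} [Fintype ι] {f : ℝ → EuclideanSpace ℝ ι}
    {f' : EuclideanSpace ℝ ι} {x : ℝ} :
    HasDerivAt f f' x ↔ ∀ i, HasDerivAt (fun t ↦ f t i) (f' i) x := by
  simp only [hasDerivAt_iff_hasFDerivAt, ← hasFDerivWithinAt_univ, hasFDerivWithinAt_euclidean]
  refine forall_congr' fun i ↦ ?_
  have : (PiLp.proj 2 (fun _ : ι ↦ ℝ) i).comp
      (ContinuousLinearMap.toSpanSingleton ℝ f') =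
      ContinuousLinearMap.toSpanSingleton ℝ (f' i) := by
    ext
    simp
  rw [this]

/-- The standard basis vector `e_i` of `E3` (`EuclideanSpace.single i 1`). [folklore] -/
abbrev E3.e (i : Fin 3) : E3 := EuclideanSpace.single i 1

/-- Expansion of a vector of `E3` in the standard basis: `v = Σ_i v_i e_i`. [folklore] -/
theorem E3.eq_sum_e (v : E3) : v = ∑ i, v i • E3.e i := by
  conv_lhs => rw [← (EuclideanSpace.basisFun (Fin 3) ℝ).sum_repr v]
  simp [EuclideanSpace.basisFun_apply]

/-- `v = v₀ e₀ + v₁ e₁ + v₂ e₂` on `E3`. [folklore] -/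
theorem E3.eq_three (v : E3) : v = v 0 • E3.e 0 + v 1 • E3.e 1 + v 2 • E3.e 2 := by
  conv_lhs => rw [E3.eq_sum_e v]
  simp [Fin.sum_univ_three]

/-! ### The frame -/

/-- The **radial unit vector** of spherical coordinates,
`n̂(θ, φ) = (cos φ sin θ, sin φ sin θ, cos θ)`. [folklore] -/
def sphRadial (θ φ : ℝ) : E3 := !₂[cos φ * sin θ, sin φ * sin θ, cos θ]

/-- The **polar unit vector** `θ̂(θ, φ) = ∂_θ n̂ = (cos φ cos θ, sin φ cos θ, −sin θ)`. [folklore] -/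
def sphPolar (θ φ : ℝ) : E3 := !₂[cos φ * cos θ, sin φ * cos θ, -sin θ]

/-- The **azimuthal unit vector** `φ̂(φ) = (−sin φ, cos φ, 0)` (`∂_φ n̂ = sin θ · φ̂`). [folklore] -/
def sphAzimuth (φ : ℝ) : E3 := !₂[-sin φ, cos φ, 0]

/-- The horizontal vector `∂_φ φ̂ = (−cos φ, −sin φ, 0)` (minus the cylindrical radial unit vector;
equal to `−(sin θ n̂ + cos θ θ̂)` for every `θ`, `sphHoriz_eq`). [folklore] -/
def sphHoriz (φ : ℝ) : E3 := !₂[-cos φ, -sin φ, 0]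

/-- Component formula. [folklore] -/
@[simp] theorem sphRadial_apply_zero (θ φ : ℝ) : sphRadial θ φ 0 = cos φ * sin θ := rfl
/-- Component formula. [folklore] -/
@[simp] theorem sphRadial_apply_one (θ φ : ℝ) : sphRadial θ φ 1 = sin φ * sin θ := rfl
/-- Component formula. [folklore] -/
@[simp] theorem sphRadial_apply_two (θ φ : ℝ) : sphRadial θ φ 2 = cos θ := rfl
/-- Component formula. [folklore] -/
@[simp] theorem sphPolar_apply_zero (θ φ : ℝ) : sphPolar θ φ 0 = cos φ * cos θ := rfl
/-- Component formula. [folklore] -/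
@[simp] theorem sphPolar_apply_one (θ φ : ℝ) : sphPolar θ φ 1 = sin φ * cos θ := rfl
/-- Component formula. [folklore] -/
@[simp] theorem sphPolar_apply_two (θ φ : ℝ) : sphPolar θ φ 2 = -sin θ := rfl
/-- Component formula. [folklore] -/
@[simp] theorem sphAzimuth_apply_zero (φ : ℝ) : sphAzimuth φ 0 = -sin φ := rfl
/-- Component formula. [folklore] -/
@[simp] theorem sphAzimuth_apply_one (φ : ℝ) : sphAzimuth φ 1 = cos φ := rfl
/-- Component formula. [folklore] -/
@[simp] theorem sphAzimuth_apply_two (φ : ℝ) : sphAzimuth φ 2 = 0 := rfl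
/-- Component formula. [folklore] -/
@[simp] theorem sphHoriz_apply_zero (φ : ℝ) : sphHoriz φ 0 = -cos φ := rfl
/-- Component formula. [folklore] -/
@[simp] theorem sphHoriz_apply_one (φ : ℝ) : sphHoriz φ 1 = -sin φ := rfl
/-- Component formula. [folklore] -/
@[simp] theorem sphHoriz_apply_two (φ : ℝ) : sphHoriz φ 2 = 0 := rfl

/-- `n̂ = cos φ sin θ e₀ + sin φ sin θ e₁ + cos θ e₂`. [folklore] -/
theorem sphRadial_eq (θ φ : ℝ) :
    sphRadial θ φ = (cos φ * sin θ) • E3.e 0 + (sin φ * sin θ) • E3.e 1 + cos θ • E3.e 2 := by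
  rw [E3.eq_three (sphRadial θ φ)]; rfl

/-- `θ̂ = cos φ cos θ e₀ + sin φ cos θ e₁ − sin θ e₂`. [folklore] -/
theorem sphPolar_eq (θ φ : ℝ) :
    sphPolar θ φ = (cos φ * cos θ) • E3.e 0 + (sin φ * cos θ) • E3.e 1 + (-sin θ) • E3.e 2 := by
  rw [E3.eq_three (sphPolar θ φ)]; rfl

/-- `φ̂ = −sin φ e₀ + cos φ e₁`. [folklore] -/
theorem sphAzimuth_eq (φ : ℝ) :
    sphAzimuth φ = (-sin φ) • E3.e 0 + cos φ • E3.e 1 + (0 : ℝ) • E3.e 2 := by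
  rw [E3.eq_three (sphAzimuth φ)]; rfl

/-- `∂_φ φ̂ = −cos φ e₀ − sin φ e₁`. [folklore] -/
theorem sphHoriz_eq_sum (φ : ℝ) :
    sphHoriz φ = (-cos φ) • E3.e 0 + (-sin φ) • E3.e 1 + (0 : ℝ) • E3.e 2 := by
  rw [E3.eq_three (sphHoriz φ)]; rfl

/-- `∂_φ φ̂ = −(sin θ n̂ + cos θ θ̂)` for every `θ` (by `sin² θ + cos² θ = 1`). [folklore] -/
theorem sphHoriz_eq (θ φ : ℝ) :
    sphHoriz φ = -(sin θ • sphRadial θ φ + cos θ • sphPolar θ φ) := by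
  have h := sin_sq_add_cos_sq θ
  ext i
  fin_cases i
  · simp only [Fin.zero_eta, Fin.isValue, sphHoriz_apply_zero, PiLp.neg_apply, PiLp.add_apply,
      PiLp.smul_apply, sphRadial_apply_zero, smul_eq_mul, sphPolar_apply_zero]
    linear_combination cos φ * h
  · simp only [Fin.mk_one, Fin.isValue, sphHoriz_apply_one, PiLp.neg_apply, PiLp.add_apply,
      PiLp.smul_apply, sphRadial_apply_one, smul_eq_mul, sphPolar_apply_one]
    linear_combination sin φ * h
  · simp only [Fin.reduceFinMk, sphHoriz_apply_two, PiLp.neg_apply, PiLp.add_apply, PiLp.smul_apply,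
      sphRadial_apply_two, smul_eq_mul, sphPolar_apply_two, Fin.isValue]
    ring

/-- `e₂ = cos θ n̂ − sin θ θ̂` (the vertical unit vector in the frame). [folklore] -/
theorem E3.e_two_eq (θ φ : ℝ) : E3.e 2 = cos θ • sphRadial θ φ - sin θ • sphPolar θ φ := by
  have h := sin_sq_add_cos_sq θ
  ext i
  fin_cases i
  · simp only [E3.e, Fin.zero_eta, Fin.isValue, PiLp.sub_apply, PiLp.smul_apply, sphRadial_apply_zero,
      smul_eq_mul, sphPolar_apply_zero, PiLp.single_apply, if_neg (show (0 : Fin 3) ≠ 2 by decide)]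
    ring
  · simp only [E3.e, Fin.mk_one, Fin.isValue, PiLp.sub_apply, PiLp.smul_apply, sphRadial_apply_one,
      smul_eq_mul, sphPolar_apply_one, PiLp.single_apply, if_neg (show (1 : Fin 3) ≠ 2 by decide)]
    ring
  · simp only [E3.e, Fin.reduceFinMk, Fin.isValue, PiLp.sub_apply, PiLp.smul_apply, sphRadial_apply_two,
      smul_eq_mul, sphPolar_apply_two, PiLp.single_apply, ↓reduceIte]
    linear_combination (-1 : ℝ) * h

/-! ### The derivative table -/

/-- `∂_θ n̂ = θ̂`. [folklore] -/
theorem hasDerivAt_sphRadial_theta (θ φ : ℝ) :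
    HasDerivAt (fun θ ↦ sphRadial θ φ) (sphPolar θ φ) θ := by
  rw [hasDerivAt_euclidean_iff]
  intro i
  fin_cases i
  · simpa using (hasDerivAt_sin θ).const_mul (cos φ)
  · simpa using (hasDerivAt_sin θ).const_mul (sin φ)
  · simpa using hasDerivAt_cos θ

/-- `∂_θ θ̂ = −n̂`. [folklore] -/
theorem hasDerivAt_sphPolar_theta (θ φ : ℝ) :
    HasDerivAt (fun θ ↦ sphPolar θ φ) (-sphRadial θ φ) θ := by
  rw [hasDerivAt_euclidean_iff]
  intro i
  fin_cases i
  · simpa using (hasDerivAt_cos θ).const_mul (cos φ)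
  · simpa using (hasDerivAt_cos θ).const_mul (sin φ)
  · show HasDerivAt (fun t ↦ -sin t) (-cos θ) θ
    exact (hasDerivAt_sin θ).neg

/-- `∂_φ n̂ = sin θ φ̂`. [folklore] -/
theorem hasDerivAt_sphRadial_phi (θ φ : ℝ) :
    HasDerivAt (fun φ ↦ sphRadial θ φ) (sin θ • sphAzimuth φ) φ := by
  rw [hasDerivAt_euclidean_iff]
  intro i
  fin_cases i
  · simpa [mul_comm] using (hasDerivAt_cos φ).mul_const (sin θ)
  · simpa [mul_comm] using (hasDerivAt_sin φ).mul_const (sin θ)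
  · simpa using hasDerivAt_const φ (cos θ)

/-- `∂_φ θ̂ = cos θ φ̂`. [folklore] -/
theorem hasDerivAt_sphPolar_phi (θ φ : ℝ) :
    HasDerivAt (fun φ ↦ sphPolar θ φ) (cos θ • sphAzimuth φ) φ := by
  rw [hasDerivAt_euclidean_iff]
  intro i
  fin_cases i
  · simpa [mul_comm] using (hasDerivAt_cos φ).mul_const (cos θ)
  · simpa [mul_comm] using (hasDerivAt_sin φ).mul_const (cos θ)
  · simpa using hasDerivAt_const φ (-sin θ)

/-- `∂_φ φ̂ = (−cos φ, −sin φ, 0)`. [folklore] -/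
theorem hasDerivAt_sphAzimuth (φ : ℝ) : HasDerivAt sphAzimuth (sphHoriz φ) φ := by
  rw [hasDerivAt_euclidean_iff]
  intro i
  fin_cases i
  · show HasDerivAt (fun t ↦ -sin t) (-cos φ) φ
    exact (hasDerivAt_sin φ).neg
  · exact hasDerivAt_cos φ
  · simp only [Fin.reduceFinMk, Fin.isValue, sphAzimuth_apply_two, sphHoriz_apply_two]
    exact hasDerivAt_const φ (0 : ℝ)

/-- `∂_φ (∂_φ φ̂) = −φ̂`. [folklore] -/
theorem hasDerivAt_sphHoriz (φ : ℝ) : HasDerivAt sphHoriz (-sphAzimuth φ) φ := by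
  rw [hasDerivAt_euclidean_iff]
  intro i
  fin_cases i
  · show HasDerivAt (fun t ↦ -cos t) (-(-sin φ)) φ
    exact (hasDerivAt_cos φ).neg
  · show HasDerivAt (fun t ↦ -sin t) (-cos φ) φ
    exact (hasDerivAt_sin φ).neg
  · simp only [Fin.reduceFinMk, Fin.isValue, sphHoriz_apply_two, PiLp.neg_apply, sphAzimuth_apply_two,
      neg_zero]
    exact hasDerivAt_const φ (0 : ℝ)

/-! ### The trace identity -/

/-- **The frame is orthonormal, in trace form**: for every continuous bilinear map `B` on `E3`
with values in a real normed space, `B(n̂, n̂) + B(θ̂, θ̂) + B(φ̂, φ̂) = Σ_i B(e_i, e_i)`. Applied to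
the second derivative `B = D²Φ(y)` this says that the flat Laplacian is the sum of the second
derivatives along any orthonormal frame. [folklore] -/
theorem sph_frame_trace {F : Type*} [NormedAddCommGroup F] [NormedSpace ℝ F]
    (B : E3 →L[ℝ] E3 →L[ℝ] F) (θ φ : ℝ) :
    B (sphRadial θ φ) (sphRadial θ φ) + B (sphPolar θ φ) (sphPolar θ φ) +
        B (sphAzimuth φ) (sphAzimuth φ) = ∑ i, B (E3.e i) (E3.e i) := by
  have hθ := sin_sq_add_cos_sq θ
  have hφ := sin_sq_add_cos_sq φ
  rw [Fin.sum_univ_three, sphRadial_eq, sphPolar_eq, sphAzimuth_eq]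
  simp only [map_add, map_smul, add_apply, FunLike.coe_smul, Pi.smul_apply, zero_smul, add_zero]
  match_scalars <;> first | ring1 | (ring_nf; simp only [Real.cos_sq']; ring1)

end Literature.Geometry.Lorentzian

end

/-! ## Part 2. Kerr's ingoing spheroidal coordinates on the leaf -/

noncomputable section

open Real Set Filter
open scoped Topology

namespace Literature.Geometry.Lorentzian

namespace Kerr

/-! ### The coordinate map -/

/-- **Kerr's ingoing spheroidal coordinates on the leaf**:
`Y_a(r, θ, φ) = r n̂(θ, φ) + a sin θ φ̂(φ) = ((r cos φ − a sin φ) sin θ, (r sin φ + a cos φ) sin θ, r cos θ)`,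
i.e. `x + iy = (r + ia) e^{iφ} sin θ`, `z = r cos θ`. Kerr 1963; Visser arXiv:0706.0622, §4.
[cite: arXiv07060622, §4] -/
def kerrStar (a r θ φ : ℝ) : E3 := r • sphRadial θ φ + (a * sin θ) • sphAzimuth φ

/-- Component formula. [folklore] -/
@[simp] theorem kerrStar_apply_zero (a r θ φ : ℝ) :
    kerrStar a r θ φ 0 = (r * cos φ - a * sin φ) * sin θ := by
  simp [kerrStar]; ring

/-- Component formula. [folklore] -/
@[simp] theorem kerrStar_apply_one (a r θ φ : ℝ) :
    kerrStar a r θ φ 1 = (r * sin φ + a * cos φ) * sin θ := by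
  simp [kerrStar]; ring

/-- Component formula. [folklore] -/
@[simp] theorem kerrStar_apply_two (a r θ φ : ℝ) : kerrStar a r θ φ 2 = r * cos θ := by
  simp [kerrStar]

/-- **The null lines are the `r`-coordinate lines**: `Y_a(r + s, θ, φ) = Y_a(r, θ, φ) + s n̂(θ, φ)`
(cf. `Kerr.radius_add_smul_nullVector`). Visser arXiv:0706.0622, §4. [cite: arXiv07060622, §4] -/
theorem kerrStar_add (a r s θ φ : ℝ) :
    kerrStar a (r + s) θ φ = kerrStar a r θ φ + s • sphRadial θ φ := by
  simp only [kerrStar, add_smul]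
  abel

/-- `∂_r Y_a = n̂`. [cite: arXiv07060622, §4] -/
theorem hasDerivAt_kerrStar_r (a r θ φ : ℝ) :
    HasDerivAt (fun r ↦ kerrStar a r θ φ) (sphRadial θ φ) r := by
  have h : (fun r' ↦ kerrStar a r' θ φ) = fun r' ↦ kerrStar a r θ φ + (r' - r) • sphRadial θ φ := by
    funext r'
    rw [← kerrStar_add]
    ring_nf
  rw [h]
  simpa using ((hasDerivAt_id r).sub_const r).smul_const (sphRadial θ φ) |>.const_add
    (kerrStar a r θ φ)

/-- `‖Y_a(r, θ, φ)‖² = r² + a² sin² θ`. Visser arXiv:0706.0622, §4. [cite: arXiv07060622, §4] -/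
theorem norm_sq_kerrStar (a r θ φ : ℝ) :
    ‖kerrStar a r θ φ‖ ^ 2 = r ^ 2 + a ^ 2 * sin θ ^ 2 := by
  have hθ := sin_sq_add_cos_sq θ
  have hφ := sin_sq_add_cos_sq φ
  rw [E3.norm_sq, kerrStar_apply_zero, kerrStar_apply_one, kerrStar_apply_two]
  linear_combination (r ^ 2 + a ^ 2 * 0) * hθ * 0 +
    ((r * cos φ - a * sin φ) ^ 2 * 0) * hφ + sin θ ^ 2 * (r ^ 2 + a ^ 2) * hφ + r ^ 2 * hθ

/-- **`Y_a` solves the defining quartic of the Kerr–Schild radius with root `r`**: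
`r⁴ − (‖Y‖² − a²) r² − a² z² = 0`, i.e. `(x² + y²)/(r² + a²) + z²/r² = 1`. Visser
arXiv:0706.0622, §4 (the two displayed consequences of the transformation). [cite: arXiv07060622, §4] -/
theorem kerrStar_quartic (a r θ φ : ℝ) :
    r ^ 4 - (‖kerrStar a r θ φ‖ ^ 2 - a ^ 2) * r ^ 2 - a ^ 2 * (kerrStar a r θ φ 2) ^ 2 = 0 := by
  rw [norm_sq_kerrStar, kerrStar_apply_two]
  linear_combination (-(a ^ 2 * r ^ 2)) * sin_sq_add_cos_sq θ

/-- **Along `Y_a` the Kerr–Schild radius is the coordinate `r`** (`r > 0`): the quartic has a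
unique positive root (`radius_eq_of_pos_of_quartic`). Visser arXiv:0706.0622, §4, (35). [cite: arXiv07060622, §4] -/
theorem radius_kerrStar (a : ℝ) {r : ℝ} (hr : 0 < r) (θ φ : ℝ) :
    radius a (E4.ofTimeSpace 0 (kerrStar a r θ φ)) = r := by
  refine radius_eq_of_pos_of_quartic hr ?_
  rw [E4.spatialNorm_ofTimeSpace, show (E4.ofTimeSpace 0 (kerrStar a r θ φ)) 3 =
    kerrStar a r θ φ 2 from E4.ofTimeSpace_apply_succ 0 _ 2]
  exact kerrStar_quartic a r θ φ

/-- `Y_a(r, θ, φ) ∈ Kerr.slice a r₀` as soon as `r > max r₀ 0`. [cite: arXiv07060622, §4] -/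
theorem kerrStar_mem_slice {a r₀ r : ℝ} (hr : max r₀ 0 < r) (θ φ : ℝ) :
    kerrStar a r θ φ ∈ slice a r₀ := by
  rw [mem_slice, radius_kerrStar a ((le_max_right r₀ 0).trans_lt hr)]
  exact hr

/-- `Σ(Y_a) = r² + a² cos² θ` — the Boyer–Lindquist `ρ²` (`blSigma = 2r² − ‖y‖² + a²`).
SR, CMP 329 (2014), §1.2.1 (`ρ² := r² + a² cos² θ`). [cite: ShlapentokhRothman2014KleinGordon, §1.2.1] -/
theorem blSigma_kerrStar (a : ℝ) {r : ℝ} (hr : 0 < r) (θ φ : ℝ) :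
    blSigma a (kerrStar a r θ φ) = r ^ 2 + a ^ 2 * cos θ ^ 2 := by
  rw [blSigma, radius_kerrStar a hr, norm_sq_kerrStar]
  linear_combination (-a ^ 2) * sin_sq_add_cos_sq θ

/-- `r² + a² cos² θ > 0` for `r ≠ 0`. [folklore] -/
theorem sq_add_sq_mul_cos_sq_pos (a : ℝ) {r : ℝ} (hr : r ≠ 0) (θ : ℝ) :
    0 < r ^ 2 + a ^ 2 * cos θ ^ 2 := by positivity

/-- **Along `Y_a` the spatial null vector is the radial unit vector**:
`ℓ⃗(Y_a(r, θ, φ)) = n̂(θ, φ) = ∂_r Y_a` (`r > 0`): with `x + iy = (r + ia)e^{iφ} sin θ`,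
`ℓ_x + iℓ_y = (r − ia)(x + iy)/(r² + a²) = e^{iφ} sin θ` and `ℓ_z = z/r = cos θ`. Kerr 1963 (`ℓ` is
`∂_r` of the coordinates `(u, r, θ, φ)`); Visser arXiv:0706.0622, (34) and §4. [cite: arXiv07060622, (34) and §4] -/
theorem nullSpatial_kerrStar (a : ℝ) {r : ℝ} (hr : 0 < r) (θ φ : ℝ) :
    nullSpatial a (E4.ofTimeSpace 0 (kerrStar a r θ φ)) = sphRadial θ φ := by
  have hra : r ^ 2 + a ^ 2 ≠ 0 := by positivity
  have h1 : (E4.ofTimeSpace 0 (kerrStar a r θ φ)) 1 = kerrStar a r θ φ 0 :=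
    E4.ofTimeSpace_apply_succ 0 _ 0
  have h2 : (E4.ofTimeSpace 0 (kerrStar a r θ φ)) 2 = kerrStar a r θ φ 1 :=
    E4.ofTimeSpace_apply_succ 0 _ 1
  have h3 : (E4.ofTimeSpace 0 (kerrStar a r θ φ)) 3 = kerrStar a r θ φ 2 :=
    E4.ofTimeSpace_apply_succ 0 _ 2
  ext i
  rw [nullSpatial_apply]
  fin_cases i
  · simp only [Fin.zero_eta, Fin.isValue, Fin.succ_zero_eq_one, nullCovectorFun,
      radius_kerrStar a hr, Matrix.cons_val_one, Matrix.cons_val_zero, sphRadial_apply_zero]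
    rw [h1, h2, kerrStar_apply_zero, kerrStar_apply_one, div_eq_iff hra]
    ring
  · simp only [Fin.mk_one, Fin.isValue, Fin.succ_one_eq_two, nullCovectorFun,
      radius_kerrStar a hr, Matrix.cons_val, sphRadial_apply_one]
    rw [h1, h2, kerrStar_apply_zero, kerrStar_apply_one, div_eq_iff hra]
    ring
  · simp only [Fin.reduceFinMk, Fin.isValue, nullCovectorFun, radius_kerrStar a hr,
      sphRadial_apply_two]
    rw [show (2 : Fin 3).succ = 3 from rfl]
    show (kerrStar a r θ φ) 2 / r = cos θ
    rw [kerrStar_apply_two, mul_div_cancel_left₀ _ hr.ne']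

/-- `H(Y_a) = M r/(r² + a² cos² θ)` (`H = Mr/Σ`). Visser arXiv:0706.0622, (33); SR §1.2.1.
[cite: arXiv07060622, (33)] -/
theorem scalarH_kerrStar (M a : ℝ) {r : ℝ} (hr : 0 < r) (θ φ : ℝ) :
    scalarH M a (E4.ofTimeSpace 0 (kerrStar a r θ φ)) = M * r / (r ^ 2 + a ^ 2 * cos θ ^ 2) := by
  have hr' : 0 < radius a (E4.ofTimeSpace 0 (kerrStar a r θ φ)) := by rwa [radius_kerrStar a hr]
  rw [scalarH_ofTimeSpace_eq 0 hr', radius_kerrStar a hr, blSigma_kerrStar a hr]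

/-! ### Elementary bounds on the leaf -/

/-- `|z| ≤ r` on the leaf (`z²/r² = 1 − (x² + y²)/(r² + a²) ≤ 1` by the quartic), `r > 0`.
Visser arXiv:0706.0622, (35). [cite: arXiv07060622, (35)] -/
theorem abs_apply_two_le_radius {a : ℝ} {y : E3} (hr : 0 < radius a (E4.ofTimeSpace 0 y)) :
    |y 2| ≤ radius a (E4.ofTimeSpace 0 y) := by
  have hq := radius_slice_quartic a y
  rw [E3.norm_sq] at hq
  set r := radius a (E4.ofTimeSpace 0 y)
  have key : (r ^ 2 + a ^ 2) * (r ^ 2 - y 2 ^ 2) = r ^ 2 * (y 0 ^ 2 + y 1 ^ 2) := by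
    linear_combination hq
  have h0 : (r ^ 2 + a ^ 2) * 0 ≤ (r ^ 2 + a ^ 2) * (r ^ 2 - y 2 ^ 2) := by
    rw [mul_zero, key]; positivity
  have h1 : y 2 ^ 2 ≤ r ^ 2 := by
    have := le_of_mul_le_mul_left h0 (by positivity : (0 : ℝ) < r ^ 2 + a ^ 2)
    linarith
  exact abs_le_of_sq_le_sq h1 hr.le

/-- `‖y‖² ≤ r² + a²` on the leaf (`‖y‖² − a² = r² − a² z²/r² ≤ r²` by the quartic), `r > 0`.
Visser arXiv:0706.0622, (35). [cite: arXiv07060622, (35)] -/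
theorem norm_sq_le_radius_sq_add {a : ℝ} {y : E3} (hr : 0 < radius a (E4.ofTimeSpace 0 y)) :
    ‖y‖ ^ 2 ≤ radius a (E4.ofTimeSpace 0 y) ^ 2 + a ^ 2 := by
  have hq := radius_slice_quartic a y
  set r := radius a (E4.ofTimeSpace 0 y)
  have hr2 : 0 < r ^ 2 := by positivity
  by_contra hlt
  push Not at hlt
  nlinarith [sq_nonneg (a * y 2), mul_lt_mul_of_pos_right hlt hr2]

/-- `‖y‖ ≤ r + |a|` on the leaf, `r > 0`. [cite: arXiv07060622, (35)] -/
theorem norm_le_radius_add_abs {a : ℝ} {y : E3} (hr : 0 < radius a (E4.ofTimeSpace 0 y)) :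
    ‖y‖ ≤ radius a (E4.ofTimeSpace 0 y) + |a| := by
  have hle : ‖y‖ ^ 2 ≤ (radius a (E4.ofTimeSpace 0 y) + |a|) ^ 2 :=
    calc ‖y‖ ^ 2 ≤ radius a (E4.ofTimeSpace 0 y) ^ 2 + a ^ 2 := norm_sq_le_radius_sq_add hr
      _ ≤ (radius a (E4.ofTimeSpace 0 y) + |a|) ^ 2 := by
          rw [← sq_abs a]; nlinarith [abs_nonneg a, hr]
  exact (pow_le_pow_iff_left₀ (norm_nonneg y) (by positivity) two_ne_zero).1 hle

/-! ### Every off-axis point of the leaf has spheroidal coordinates -/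

/-- **Surjectivity off the axis**: a point `y` of the leaf with `r = r(0, y) > 0` and
`(y₀, y₁) ≠ (0, 0)` is `Y_a(r, θ, φ)` with `θ = arccos(z/r) ∈ (0, π)` and `φ = arg((x + iy)/(r + ia))`
(`|(x + iy)/(r + ia)|² = (x² + y²)/(r² + a²) = 1 − z²/r² = sin² θ` by the quartic). Visser
arXiv:0706.0622, §4. [cite: arXiv07060622, §4] -/
theorem exists_kerrStar_eq {a : ℝ} {y : E3} (hr : 0 < radius a (E4.ofTimeSpace 0 y))
    (hy : y 0 ≠ 0 ∨ y 1 ≠ 0) :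
    ∃ θ ∈ Ioo 0 π, ∃ φ : ℝ, kerrStar a (radius a (E4.ofTimeSpace 0 y)) θ φ = y := by
  set r := radius a (E4.ofTimeSpace 0 y) with hr_def
  have hq := radius_slice_quartic a y
  rw [E3.norm_sq, ← hr_def] at hq
  -- the complex number `w = (x + iy)/(r + ia)`
  set ζ : ℂ := (y 0 : ℂ) + (y 1 : ℂ) * Complex.I with hζ
  set ρ : ℂ := (r : ℂ) + (a : ℂ) * Complex.I with hρ
  have hρ0 : ρ ≠ 0 := by
    intro h
    have := congrArg Complex.re h
    simp [hρ] at this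
    exact hr.ne' this
  have hζ0 : ζ ≠ 0 := by
    intro h
    have h0 := congrArg Complex.re h
    have h1 := congrArg Complex.im h
    simp [hζ] at h0 h1
    rcases hy with hy | hy
    · exact hy h0
    · exact hy h1
  set w : ℂ := ζ / ρ with hw
  have hw0 : w ≠ 0 := div_ne_zero hζ0 hρ0
  have hnormρ : ‖ρ‖ ^ 2 = r ^ 2 + a ^ 2 := by
    rw [Complex.sq_norm, hρ, Complex.normSq_add_mul_I]
  have hnormζ : ‖ζ‖ ^ 2 = y 0 ^ 2 + y 1 ^ 2 := by
    rw [Complex.sq_norm, hζ, Complex.normSq_add_mul_I]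
  have hra : 0 < r ^ 2 + a ^ 2 := by positivity
  have hnormw : ‖w‖ ^ 2 = 1 - (y 2 / r) ^ 2 := by
    rw [hw, norm_div, div_pow, hnormρ, hnormζ, div_pow, eq_sub_iff_add_eq, div_add_div _ _ hra.ne'
      (pow_ne_zero 2 hr.ne'), div_eq_one_iff_eq (mul_ne_zero hra.ne' (pow_ne_zero 2 hr.ne'))]
    linear_combination (-1 : ℝ) * hq
  -- the angles
  set c : ℝ := y 2 / r with hc
  have hc1 : c ^ 2 ≤ 1 := by nlinarith [norm_nonneg w, hnormw]
  have hcle : c ≤ 1 := by nlinarith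
  have hcge : -1 ≤ c := by nlinarith
  set θ : ℝ := arccos c with hθ
  have hcos : cos θ = c := cos_arccos hcge hcle
  have hsin : sin θ = ‖w‖ := by
    rw [hθ, sin_arccos, ← hnormw, Real.sqrt_sq (norm_nonneg w)]
  have hsin_pos : 0 < sin θ := by rw [hsin]; exact norm_pos_iff.2 hw0
  have hθmem : θ ∈ Ioo 0 π := by
    refine ⟨lt_of_le_of_ne (arccos_nonneg c) fun h ↦ ?_, lt_of_le_of_ne (arccos_le_pi c) fun h ↦ ?_⟩
    · rw [← h, sin_zero] at hsin_pos; exact lt_irrefl _ hsin_pos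
    · rw [h, sin_pi] at hsin_pos; exact lt_irrefl _ hsin_pos
  set φ : ℝ := Complex.arg w with hφ
  refine ⟨θ, hθmem, φ, ?_⟩
  -- `(r + ia) e^{iφ} sin θ = (r + ia) w = x + iy`
  have hexp : (sin θ : ℂ) * Complex.exp (φ * Complex.I) = w := by
    rw [hsin]; exact Complex.norm_mul_exp_arg_mul_I w
  have hkey : ρ * ((sin θ : ℂ) * Complex.exp (φ * Complex.I)) = ζ := by
    rw [hexp, hw, mul_div_cancel₀ _ hρ0]
  have hre := congrArg Complex.re hkey
  have him := congrArg Complex.im hkey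
  simp only [hρ, hζ, Complex.exp_mul_I, Complex.mul_re, Complex.mul_im, Complex.add_re,
    Complex.add_im, Complex.ofReal_re, Complex.ofReal_im, Complex.I_re, Complex.I_im,
    Complex.cos_ofReal_re, Complex.sin_ofReal_re, Complex.cos_ofReal_im, Complex.sin_ofReal_im,
    mul_zero, mul_one, zero_add, add_zero, sub_zero, zero_mul] at hre him
  ext i
  fin_cases i
  · show kerrStar a r θ φ 0 = y 0
    rw [kerrStar_apply_zero, ← hre]
    ring
  · show kerrStar a r θ φ 1 = y 1
    rw [kerrStar_apply_one, ← him]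
    ring
  · show kerrStar a r θ φ 2 = y 2
    rw [kerrStar_apply_two, hcos, hc, mul_div_cancel₀ _ hr.ne']

/-! ### Passing to the axis by continuity -/

/-- **Off-axis points are dense in the slice, in the form used for identities**: a function which
is continuous on `Kerr.slice a r₀` and takes the value `c` at every off-axis point of the slice
takes the value `c` everywhere on the slice (approach an axis point `y` by `y + t e₀`, `t → 0`,
inside the open slice). [folklore] -/
theorem eqOn_slice_of_offAxis {X : Type*} [TopologicalSpace X] [T2Space X] {a r₀ : ℝ}
    {G : E3 → X} {c : X} (hG : ContinuousOn G (slice a r₀))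
    (h : ∀ y ∈ slice a r₀, (y 0 ≠ 0 ∨ y 1 ≠ 0) → G y = c) :
    ∀ y ∈ slice a r₀, G y = c := by
  intro y hy
  by_cases hax : y 0 ≠ 0 ∨ y 1 ≠ 0
  · exact h y hy hax
  push Not at hax
  -- the curve `t ↦ y + t e₀` through the axis point `y`
  set γ : ℝ → E3 := fun t ↦ y + t • E3.e 0 with hγ
  have hγc : Continuous γ := by fun_prop
  have hγ0 : γ 0 = y := by simp [hγ]
  have hopen : IsOpen (slice a r₀ : Set E3) := (slice a r₀).isOpen
  -- eventually (for `t` near `0`) the curve stays in the slice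
  have hev : ∀ᶠ t in 𝓝 (0 : ℝ), γ t ∈ (slice a r₀ : Set E3) := by
    have : (slice a r₀ : Set E3) ∈ 𝓝 (γ 0) := by rw [hγ0]; exact hopen.mem_nhds hy
    exact hγc.continuousAt.preimage_mem_nhds this
  -- and for `t ≠ 0` it is off the axis, so `G ∘ γ = c` there
  have hev' : ∀ᶠ t in 𝓝[≠] (0 : ℝ), G (γ t) = c := by
    filter_upwards [mem_nhdsWithin_of_mem_nhds hev, self_mem_nhdsWithin] with t ht ht0
    refine h _ ht (Or.inl ?_)
    simp [hγ, hax.1, E3.e]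
    exact ht0
  -- continuity of `G` within the slice along the curve
  have htend : Tendsto (fun t ↦ G (γ t)) (𝓝[≠] (0 : ℝ)) (𝓝 (G y)) := by
    have h1 : Tendsto γ (𝓝[≠] (0 : ℝ)) (𝓝[(slice a r₀ : Set E3)] y) := by
      refine tendsto_nhdsWithin_iff.2 ⟨?_, mem_nhdsWithin_of_mem_nhds hev⟩
      rw [← hγ0]
      exact hγc.continuousAt.tendsto.mono_left nhdsWithin_le_nhds
    exact (hG y hy).tendsto.comp h1
  have hconst : Tendsto (fun t ↦ G (γ t)) (𝓝[≠] (0 : ℝ)) (𝓝 c) :=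
    tendsto_const_nhds.congr' (hev'.mono fun t ht ↦ ht.symm)
  exact tendsto_nhds_unique htend hconst

end Kerr

end Literature.Geometry.Lorentzian

end

/-! ## Part 3. The flat Laplacian in Kerr's ingoing spheroidal coordinates -/

noncomputable section

open Real Set Filter Laplacian
open scoped Topology

namespace Literature.Geometry.Lorentzian

namespace Kerr

/-! ### Two identities of linear algebra -/

/-- The bilinear identity behind the spheroidal Laplacian: for any bilinear `B` and vectors
`n, t, p`, with `T = r t + a cos θ p` and `P = r p − a (sin θ n + cos θ t)`,
`(r² + a²) B(n,n) + B(T,T) + B(P,P) + a sin θ (B(n,P) + B(P,n)) = (r² + a² cos² θ)(B(n,n) + B(t,t) + B(p,p))`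
whenever `n, t, p` are pairwise `B`-"orthogonal in trace", here for ALL `B` as a formal identity in the
nine values `B(·,·)` (it only uses `sin² θ + cos² θ = 1`). [folklore] -/
theorem frame_bilinear_identity {F : Type*} [AddCommGroup F] [Module ℝ F]
    (B : E3 →ₗ[ℝ] E3 →ₗ[ℝ] F) (n t p : E3) (a r θ : ℝ) :
    (r ^ 2 + a ^ 2) • B n n + B (r • t + (a * cos θ) • p) (r • t + (a * cos θ) • p) +
        B (r • p - a • (sin θ • n + cos θ • t)) (r • p - a • (sin θ • n + cos θ • t)) +
        (a * sin θ) • (B n (r • p - a • (sin θ • n + cos θ • t)) +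
          B (r • p - a • (sin θ • n + cos θ • t)) n) =
      (r ^ 2 + a ^ 2 * cos θ ^ 2) • (B n n + B t t + B p p) := by
  have hθ := sin_sq_add_cos_sq θ
  simp only [map_add, map_sub, map_smul, LinearMap.add_apply, LinearMap.sub_apply,
    LinearMap.smul_apply]
  match_scalars <;> first | ring1 | (ring_nf; simp only [Real.cos_sq']; ring1)

/-- The vector identity behind the spheroidal Laplacian (vanishing of the first-order terms):
`2r n + (cos θ/sin θ)(r t + a cos θ p) − (r n + a sin θ p) + (1/sin θ)(−r (sin θ n + cos θ t) − a p)
+ 2 a sin θ p = 0` for `sin θ ≠ 0`. [folklore] -/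
theorem frame_vector_identity (n t p : E3) (a r : ℝ) {θ : ℝ} (hθ : sin θ ≠ 0) :
    (2 * r) • n + (cos θ / sin θ) • (r • t + (a * cos θ) • p) + (r • -n + -(a * sin θ) • p) +
        (sin θ)⁻¹ • (r • -(sin θ • n + cos θ • t) - a • p) + (2 * (a * sin θ)) • p = 0 := by
  have h := sin_sq_add_cos_sq θ
  have key : cos θ / sin θ * (a * cos θ) + -(a * sin θ) + -((sin θ)⁻¹ * a) + 2 * (a * sin θ) = 0 := by
    field_simp
    linear_combination a * h
  calc (2 * r) • n + (cos θ / sin θ) • (r • t + (a * cos θ) • p) + (r • -n + -(a * sin θ) • p) +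
        (sin θ)⁻¹ • (r • -(sin θ • n + cos θ • t) - a • p) + (2 * (a * sin θ)) • p
      = (2 * r - r - (sin θ)⁻¹ * r * sin θ) • n + (cos θ / sin θ * r - (sin θ)⁻¹ * r * cos θ) • t +
          (cos θ / sin θ * (a * cos θ) + -(a * sin θ) + -((sin θ)⁻¹ * a) + 2 * (a * sin θ)) • p := by
        module
    _ = 0 := by
        have k1 : 2 * r - r - (sin θ)⁻¹ * r * sin θ = 0 := by field_simp; ring
        have k2 : cos θ / sin θ * r - (sin θ)⁻¹ * r * cos θ = 0 := by ring
        rw [key, k1, k2]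
        simp

/-! ### Derivatives of the coordinate curves -/

/-- `∂_θ Y_a = r θ̂ + a cos θ φ̂`. [cite: arXiv07060622, §4] -/
theorem hasDerivAt_kerrStar_theta (a r θ φ : ℝ) :
    HasDerivAt (fun θ ↦ kerrStar a r θ φ) (r • sphPolar θ φ + (a * cos θ) • sphAzimuth φ) θ := by
  unfold kerrStar
  exact ((hasDerivAt_sphRadial_theta θ φ).const_smul r).add
    (((hasDerivAt_sin θ).const_mul a).smul_const (sphAzimuth φ))

/-- `∂_θ (r θ̂ + a cos θ φ̂) = −(r n̂ + a sin θ φ̂) = −Y_a`. [folklore] -/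
theorem hasDerivAt_kerrStar_theta_theta (a r θ φ : ℝ) :
    HasDerivAt (fun θ ↦ r • sphPolar θ φ + (a * cos θ) • sphAzimuth φ)
      (r • -sphRadial θ φ + -(a * sin θ) • sphAzimuth φ) θ := by
  refine ((hasDerivAt_sphPolar_theta θ φ).const_smul r).add ?_
  simpa using ((hasDerivAt_cos θ).const_mul a).smul_const (sphAzimuth φ)

/-- `∂_φ Y_a = sin θ (r φ̂ + a ∂_φφ̂)` (`= sin θ (r φ̂ − a sin θ n̂ − a cos θ θ̂)`). [cite: arXiv07060622, §4] -/
theorem hasDerivAt_kerrStar_phi (a r θ φ : ℝ) :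
    HasDerivAt (fun φ ↦ kerrStar a r θ φ) (sin θ • (r • sphAzimuth φ + a • sphHoriz φ)) φ := by
  unfold kerrStar
  have h := ((hasDerivAt_sphRadial_phi θ φ).const_smul r).add
    ((hasDerivAt_sphAzimuth φ).const_smul (a * sin θ))
  exact h.congr_deriv (by module)

/-- `∂_φ (sin θ (r φ̂ + a ∂_φφ̂)) = sin θ (r ∂_φφ̂ − a φ̂)`. [folklore] -/
theorem hasDerivAt_kerrStar_phi_phi (a r θ φ : ℝ) :
    HasDerivAt (fun φ ↦ sin θ • (r • sphAzimuth φ + a • sphHoriz φ))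
      (sin θ • (r • sphHoriz φ - a • sphAzimuth φ)) φ := by
  have h := (((hasDerivAt_sphAzimuth φ).const_smul r).add
    ((hasDerivAt_sphHoriz φ).const_smul a)).const_smul (sin θ)
  exact h.congr_deriv (by module)

/-- `∂_r (sin θ (r φ̂ + a ∂_φφ̂)) = sin θ φ̂`. [folklore] -/
theorem hasDerivAt_kerrStar_phi_r (a r θ φ : ℝ) :
    HasDerivAt (fun r ↦ sin θ • (r • sphAzimuth φ + a • sphHoriz φ)) (sin θ • sphAzimuth φ) r := by
  have h := (((hasDerivAt_id r).smul_const (sphAzimuth φ)).add_const (a • sphHoriz φ)).const_smul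
    (sin θ)
  exact h.congr_deriv (by simp)

/-! ### Chain rule along curves -/

section ChainRule

variable {F : Type*} [NormedAddCommGroup F] [NormedSpace ℝ F]

/-- First derivative of `Φ` along a curve: `(Φ ∘ γ)'(t₀) = DΦ(γ t₀)(γ'(t₀))`. [folklore] -/
theorem hasDerivAt_comp_curve {Φ : E3 → F} {γ : ℝ → E3} {v : E3} {t₀ : ℝ}
    (hΦ : DifferentiableAt ℝ Φ (γ t₀)) (hγ : HasDerivAt γ v t₀) :
    HasDerivAt (fun t ↦ Φ (γ t)) (fderiv ℝ Φ (γ t₀) v) t₀ :=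
  hΦ.hasFDerivAt.comp_hasDerivAt t₀ hγ

/-- Derivative of `t ↦ DΦ(γ t)(δ t)`: `D²Φ(γ t₀)(γ' t₀)(δ t₀) + DΦ(γ t₀)(δ' t₀)`. [folklore] -/
theorem hasDerivAt_fderiv_comp_curve {Φ : E3 → F} {γ δ : ℝ → E3} {v w : E3} {t₀ : ℝ}
    (hΦ : DifferentiableAt ℝ (fderiv ℝ Φ) (γ t₀)) (hγ : HasDerivAt γ v t₀) (hδ : HasDerivAt δ w t₀) :
    HasDerivAt (fun t ↦ fderiv ℝ Φ (γ t) (δ t))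
      (fderiv ℝ (fderiv ℝ Φ) (γ t₀) v (δ t₀) + fderiv ℝ Φ (γ t₀) w) t₀ := by
  have h1 : HasDerivAt (fun t ↦ fderiv ℝ Φ (γ t)) (fderiv ℝ (fderiv ℝ Φ) (γ t₀) v) t₀ :=
    hΦ.hasFDerivAt.comp_hasDerivAt t₀ hγ
  exact h1.clm_apply hδ

/-- Along a curve through a point where `Φ` is `C²`, eventually `(Φ ∘ γ)' = DΦ(γ ·)(γ' ·)`.
[folklore] -/
theorem deriv_comp_curve_eventuallyEq {Φ : E3 → F} {γ : ℝ → E3} {γ' : ℝ → E3} {t₀ : ℝ}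
    (hΦ : ContDiffAt ℝ 2 Φ (γ t₀)) (hγc : ContinuousAt γ t₀) (hγ : ∀ t, HasDerivAt γ (γ' t) t) :
    deriv (fun t ↦ Φ (γ t)) =ᶠ[𝓝 t₀] fun t ↦ fderiv ℝ Φ (γ t) (γ' t) := by
  have hev : ∀ᶠ y in 𝓝 (γ t₀), ContDiffAt ℝ 2 Φ y := hΦ.eventually (by simp)
  filter_upwards [hγc.eventually hev] with t ht
  exact (hasDerivAt_comp_curve (ht.differentiableAt (by simp)) (hγ t)).deriv

end ChainRule

/-! ### The Laplacian in spheroidal coordinates -/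

section Laplacian

variable {F : Type*} [NormedAddCommGroup F] [NormedSpace ℝ F]

/-- The Euclidean Laplacian of `E3` is the sum of second derivatives along the spherical frame:
`ΔΦ(y) = D²Φ(y)(n̂, n̂) + D²Φ(y)(θ̂, θ̂) + D²Φ(y)(φ̂, φ̂)` for every `(θ, φ)`. [folklore] -/
theorem laplacian_eq_frame (Φ : E3 → F) (y : E3) (θ φ : ℝ) :
    Δ Φ y = fderiv ℝ (fderiv ℝ Φ) y (sphRadial θ φ) (sphRadial θ φ) +
      fderiv ℝ (fderiv ℝ Φ) y (sphPolar θ φ) (sphPolar θ φ) +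
      fderiv ℝ (fderiv ℝ Φ) y (sphAzimuth φ) (sphAzimuth φ) := by
  rw [InnerProductSpace.laplacian_eq_iteratedFDeriv_orthonormalBasis Φ (EuclideanSpace.basisFun (Fin 3) ℝ)]
  simp only [iteratedFDeriv_two_apply, Matrix.cons_val_zero, Matrix.cons_val_one,
    EuclideanSpace.basisFun_apply]
  exact (sph_frame_trace (fderiv ℝ (fderiv ℝ Φ) y) θ φ).symm

/-- **The flat Laplacian in Kerr's ingoing spheroidal coordinates.** Let `Φ : E3 → F` be `C²` at
`y = Y_a(r, θ, φ)` with `sin θ ≠ 0`, and write `F(r, θ, φ) = Φ(Y_a(r, θ, φ))`. Then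
`(r² + a² cos² θ) ΔΦ(y) = ∂_r((r² + a²)∂_r F) + (sin θ)⁻¹ ∂_θ(sin θ ∂_θ F) + (sin² θ)⁻¹ ∂_φ∂_φ F
 + a (∂_r∂_φ F + ∂_φ∂_r F)`, all partial derivatives being one-variable `deriv`s at `(r, θ, φ)`.
This is the Laplacian of flat `ℝ³` in the coordinates `x + iy = (r + ia)e^{iφ} sin θ`, `z = r cos θ`
(the `M = 0` case of the Kerr wave operator in Kerr-star coordinates, SR CMP 329 (2014) §1.2.1;
Visser arXiv:0706.0622 §4). [cite: arXiv07060622, §4] -/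
theorem laplacian_kerrStar {Φ : E3 → F} {a r θ φ : ℝ} (hθ : sin θ ≠ 0)
    (hΦ : ContDiffAt ℝ 2 Φ (kerrStar a r θ φ)) :
    (r ^ 2 + a ^ 2 * cos θ ^ 2) • Δ Φ (kerrStar a r θ φ) =
      deriv (fun s ↦ (s ^ 2 + a ^ 2) • deriv (fun s' ↦ Φ (kerrStar a s' θ φ)) s) r +
      (sin θ)⁻¹ • deriv (fun t ↦ sin t • deriv (fun t' ↦ Φ (kerrStar a r t' φ)) t) θ +
      (sin θ ^ 2)⁻¹ • deriv (fun p ↦ deriv (fun p' ↦ Φ (kerrStar a r θ p')) p) φ +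
      a • (deriv (fun s ↦ deriv (fun p ↦ Φ (kerrStar a s θ p)) φ) r +
        deriv (fun p ↦ deriv (fun s ↦ Φ (kerrStar a s θ p)) r) φ) := by
  have hΦ2 : DifferentiableAt ℝ (fderiv ℝ Φ) (kerrStar a r θ φ) :=
    (hΦ.fderiv_right (m := 1) le_rfl).differentiableAt (by simp)
  have hev : ∀ᶠ y' in 𝓝 (kerrStar a r θ φ), ContDiffAt ℝ 2 Φ y' := hΦ.eventually (by simp)
  -- the coordinate curves and their derivatives
  have hYr : ∀ s, HasDerivAt (fun s ↦ kerrStar a s θ φ) (sphRadial θ φ) s := fun s ↦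
    hasDerivAt_kerrStar_r a s θ φ
  have hYθ : ∀ t', HasDerivAt (fun t' ↦ kerrStar a r t' φ)
      (r • sphPolar t' φ + (a * cos t') • sphAzimuth φ) t' := fun t' ↦ hasDerivAt_kerrStar_theta a r t' φ
  have hYφ : ∀ p', HasDerivAt (fun p' ↦ kerrStar a r θ p')
      (sin θ • (r • sphAzimuth p' + a • sphHoriz p')) p' := fun p' ↦ hasDerivAt_kerrStar_phi a r θ p'
  -- (1) the radial term
  have h1ev : (fun s ↦ (s ^ 2 + a ^ 2) • deriv (fun s' ↦ Φ (kerrStar a s' θ φ)) s) =ᶠ[𝓝 r]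
      fun s ↦ (s ^ 2 + a ^ 2) • fderiv ℝ Φ (kerrStar a s θ φ) (sphRadial θ φ) := by
    filter_upwards [deriv_comp_curve_eventuallyEq (γ := fun s ↦ kerrStar a s θ φ) (t₀ := r) hΦ
      (hasDerivAt_kerrStar_r a r θ φ).continuousAt hYr] with s hs
    rw [hs]
  have h1 : deriv (fun s ↦ (s ^ 2 + a ^ 2) • deriv (fun s' ↦ Φ (kerrStar a s' θ φ)) s) r =
      (r ^ 2 + a ^ 2) • fderiv ℝ (fderiv ℝ Φ) (kerrStar a r θ φ) (sphRadial θ φ) (sphRadial θ φ) +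
        (2 * r) • fderiv ℝ Φ (kerrStar a r θ φ) (sphRadial θ φ) := by
    have hsq : HasDerivAt (fun s : ℝ ↦ s ^ 2 + a ^ 2) (2 * r) r := by
      simpa using ((hasDerivAt_id r).pow 2).add_const (a ^ 2)
    have hin : HasDerivAt (fun s ↦ fderiv ℝ Φ (kerrStar a s θ φ) (sphRadial θ φ))
        (fderiv ℝ (fderiv ℝ Φ) (kerrStar a r θ φ) (sphRadial θ φ) (sphRadial θ φ) +
          fderiv ℝ Φ (kerrStar a r θ φ) 0) r :=
      hasDerivAt_fderiv_comp_curve (γ := fun s ↦ kerrStar a s θ φ) (t₀ := r) hΦ2 (hYr r)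
        (hasDerivAt_const r _)
    rw [h1ev.deriv_eq, (hsq.fun_smul hin).deriv, map_zero, add_zero, add_comm]
  -- (2) the polar term
  have h2ev : (fun t' ↦ sin t' • deriv (fun t'' ↦ Φ (kerrStar a r t'' φ)) t') =ᶠ[𝓝 θ]
      fun t' ↦ sin t' • fderiv ℝ Φ (kerrStar a r t' φ)
        (r • sphPolar t' φ + (a * cos t') • sphAzimuth φ) := by
    filter_upwards [deriv_comp_curve_eventuallyEq (γ := fun t' ↦ kerrStar a r t' φ) (t₀ := θ) hΦ
      (hasDerivAt_kerrStar_theta a r θ φ).continuousAt hYθ] with s hs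
    rw [hs]
  have h2 : deriv (fun t' ↦ sin t' • deriv (fun t'' ↦ Φ (kerrStar a r t'' φ)) t') θ =
      sin θ • (fderiv ℝ (fderiv ℝ Φ) (kerrStar a r θ φ) (r • sphPolar θ φ + (a * cos θ) • sphAzimuth φ)
          (r • sphPolar θ φ + (a * cos θ) • sphAzimuth φ) +
        fderiv ℝ Φ (kerrStar a r θ φ) (r • -sphRadial θ φ + -(a * sin θ) • sphAzimuth φ)) +
      cos θ • fderiv ℝ Φ (kerrStar a r θ φ) (r • sphPolar θ φ + (a * cos θ) • sphAzimuth φ) := by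
    have hin := hasDerivAt_fderiv_comp_curve (γ := fun t' ↦ kerrStar a r t' φ) (t₀ := θ) hΦ2 (hYθ θ)
      (hasDerivAt_kerrStar_theta_theta a r θ φ)
    rw [h2ev.deriv_eq, ((hasDerivAt_sin θ).fun_smul hin).deriv]
  -- (3) the azimuthal term
  have h3ev : deriv (fun p' ↦ Φ (kerrStar a r θ p')) =ᶠ[𝓝 φ]
      fun p' ↦ fderiv ℝ Φ (kerrStar a r θ p') (sin θ • (r • sphAzimuth p' + a • sphHoriz p')) :=
    deriv_comp_curve_eventuallyEq (γ := fun p' ↦ kerrStar a r θ p') (t₀ := φ) hΦ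
      (hasDerivAt_kerrStar_phi a r θ φ).continuousAt hYφ
  have h3 : deriv (fun p' ↦ deriv (fun p'' ↦ Φ (kerrStar a r θ p'')) p') φ =
      fderiv ℝ (fderiv ℝ Φ) (kerrStar a r θ φ) (sin θ • (r • sphAzimuth φ + a • sphHoriz φ))
          (sin θ • (r • sphAzimuth φ + a • sphHoriz φ)) +
        fderiv ℝ Φ (kerrStar a r θ φ) (sin θ • (r • sphHoriz φ - a • sphAzimuth φ)) := by
    rw [h3ev.deriv_eq]
    exact (hasDerivAt_fderiv_comp_curve (γ := fun p' ↦ kerrStar a r θ p') (t₀ := φ) hΦ2 (hYφ φ)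
      (hasDerivAt_kerrStar_phi_phi a r θ φ)).deriv
  -- (4) the mixed term `∂_r ∂_φ`
  have h4ev : (fun s ↦ deriv (fun p' ↦ Φ (kerrStar a s θ p')) φ) =ᶠ[𝓝 r]
      fun s ↦ fderiv ℝ Φ (kerrStar a s θ φ) (sin θ • (s • sphAzimuth φ + a • sphHoriz φ)) := by
    filter_upwards [(hasDerivAt_kerrStar_r a r θ φ).continuousAt.eventually hev] with s hs
    exact (hasDerivAt_comp_curve (γ := fun p' ↦ kerrStar a s θ p') (t₀ := φ)
      (hs.differentiableAt (by simp)) (hasDerivAt_kerrStar_phi a s θ φ)).deriv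
  have h4 : deriv (fun s ↦ deriv (fun p' ↦ Φ (kerrStar a s θ p')) φ) r =
      fderiv ℝ (fderiv ℝ Φ) (kerrStar a r θ φ) (sphRadial θ φ)
          (sin θ • (r • sphAzimuth φ + a • sphHoriz φ)) +
        fderiv ℝ Φ (kerrStar a r θ φ) (sin θ • sphAzimuth φ) := by
    rw [h4ev.deriv_eq]
    exact (hasDerivAt_fderiv_comp_curve (γ := fun s ↦ kerrStar a s θ φ) (t₀ := r) hΦ2 (hYr r)
      (hasDerivAt_kerrStar_phi_r a r θ φ)).deriv
  -- (5) the mixed term `∂_φ ∂_r`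
  have h5ev : (fun p' ↦ deriv (fun s ↦ Φ (kerrStar a s θ p')) r) =ᶠ[𝓝 φ]
      fun p' ↦ fderiv ℝ Φ (kerrStar a r θ p') (sphRadial θ p') := by
    filter_upwards [(hasDerivAt_kerrStar_phi a r θ φ).continuousAt.eventually hev] with p' hp'
    exact (hasDerivAt_comp_curve (γ := fun s ↦ kerrStar a s θ p') (t₀ := r)
      (hp'.differentiableAt (by simp)) (hasDerivAt_kerrStar_r a r θ p')).deriv
  have h5 : deriv (fun p' ↦ deriv (fun s ↦ Φ (kerrStar a s θ p')) r) φ =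
      fderiv ℝ (fderiv ℝ Φ) (kerrStar a r θ φ) (sin θ • (r • sphAzimuth φ + a • sphHoriz φ))
          (sphRadial θ φ) +
        fderiv ℝ Φ (kerrStar a r θ φ) (sin θ • sphAzimuth φ) := by
    rw [h5ev.deriv_eq]
    exact (hasDerivAt_fderiv_comp_curve (γ := fun p' ↦ kerrStar a r θ p') (t₀ := φ) hΦ2 (hYφ φ)
      (hasDerivAt_sphRadial_phi θ φ)).deriv
  -- assemble: the bilinear identity for `D²Φ` and the vector identity inside `DΦ`
  have hB := frame_bilinear_identity
    ((fderiv ℝ (fderiv ℝ Φ) (kerrStar a r θ φ) : E3 →L[ℝ] E3 →L[ℝ] F).toLinearMap₁₂)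
    (sphRadial θ φ) (sphPolar θ φ) (sphAzimuth φ) a r θ
  simp only [ContinuousLinearMap.toLinearMap₁₂_apply] at hB
  have hV : fderiv ℝ Φ (kerrStar a r θ φ) ((2 * r) • sphRadial θ φ +
      (cos θ / sin θ) • (r • sphPolar θ φ + (a * cos θ) • sphAzimuth φ) +
      (r • -sphRadial θ φ + -(a * sin θ) • sphAzimuth φ) +
      (sin θ)⁻¹ • (r • -(sin θ • sphRadial θ φ + cos θ • sphPolar θ φ) - a • sphAzimuth φ) +
      (2 * (a * sin θ)) • sphAzimuth φ) = 0 := by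
    rw [frame_vector_identity _ _ _ a r hθ, map_zero]
  rw [laplacian_eq_frame Φ _ θ φ, ← hB, ← add_zero (_ + (a * sin θ) • _), ← hV, h1, h2, h3, h4, h5,
    sphHoriz_eq θ φ]
  simp only [map_add, map_sub, map_smul, map_neg, add_apply, sub_apply, FunLike.coe_smul,
    Pi.smul_apply, neg_apply, smul_add, smul_sub, smul_neg, smul_smul, neg_smul]
  match_scalars <;> (field_simp; try ring)

end Laplacian

end Kerr

end Literature.Geometry.Lorentzian

end
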